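import Summits.Ventures.PercRepro.ProfileBiIndepNormConsSep
import Summits.Ventures.PercRepro.ProfilePointedColoopExtension

/-!
# PercRepro — (NC) IS CLOSED UNDER ADDING A COLOOP, MODULO THEOREM A: MINIMAL (NC)-WITNESSES ARE COLOOP-FREE
(p10, gen 29; proofs/P10-NC-g29.md §7)

Let `e` be a COLOOP of `M` (`ρ(E ∖ e) + 1 = ρ(E)`, the lane's convention) and `M′ = M ∖ e`.  The flats of `M` are the
flats `F` of `M′` and the sets `F ∪ e`; an up-set `U` of flats of `M` gives two up-sets of flats of `M′`,
`U₀ = {F ∈ U : e ∉ F}` and `U₁ = {F ∖ e : F ∈ U, e ∈ F}`, with `U₀ ⊆ U₁`.  The bi-independent `j`-sets of `M` split by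
`e ∈ X` (gen 13) and the split respects the closures (`cl_{M′} X = cl_M X` for `X ∌ e`, `cl_M (X ∪ e) = cl_M X ∪ e`):
`u_j(M, U) = u_j(M′, U₀) + u_{j−1}(M′, U₁)` (`upCount_coloop`), `P_j(M) = P_j(M′) + P_{j−1}(M′)`.
**`normConsStep_coloop_of_lc`**: the step of (NC) for `(M, U)` at level `j ≥ 1` follows from the step of `(M′, U₀)` at
level `j`, the step of `(M′, U₁)` at level `j − 1`, `u_j(M′, U₀) ≤ u_j(M′, U₁)` and the LOG-CONCAVITY
`P_{j−1}(M′) P_{j+1}(M′) ≤ P_j(M′)²` (the flow picture: the `e`-free part sends the fraction `θ = N_j P_{j+1}/(N_{j+1} P_j)`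
of its mass up inside `M′`, the rest across `X ↦ X ∪ e`; `θ ≤ 1` IS the log-concavity; in counts
`(a_{j+1} + b_j) N_j P_j − (a_j + b_{j−1}) N_{j+1} P_j ≥ (b_j − a_j)(P_j² − P_{j−1}P_{j+1}) ≥ 0`, `step_coloop_arith`).
Level `0` is unconditional (`normConsStep_zero`).  With Theorem A's log-concavity (the named fact, through
`choose_mul_choose_le_sq`): **`normConsAt_of_delete_coloop_of_fact`** — (NC) for `M ∖ e` gives (NC) for `M`;
**`not_normConsAt_delete_coloop_of_fact`** — an (NC)-witness with a coloop has an (NC)-witness on fewer elements: modulo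
Theorem A, (NC) is EQUIVALENT to its restriction to coloop-free matroids (gen 22's theorem for (Ĉ), now for (NC)).
Nothing here asserts (NC) or Theorem A.
-/

open scoped Matroid

namespace PercRepro.Cogirth

open Finset ThmH Skew

variable {α : Type} [DecidableEq α] {M : Matroid α} [M.Finite]

/-! ### The steps at level `0` are unconditional -/

/-- (NC) at level `0` holds for every matroid and every up-set: if `cl ∅ ∈ U` then every flat lies in `U`. -/
theorem normConsStep_zero {U : Finset (Finset α)} (hU : UpFlats M U) : NormConsStep M U 0 := by
  unfold NormConsStep
  by_cases h0 : clF M ∅ ∈ U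
  · have h1 : upCount M U 1 = (biIndepSets M 1).card := by
      unfold upCount
      exact congrArg card (filter_true_of_mem fun X _ => hU.up _ h0 _ (isFlatF_clF X) (clF_mono_fu (empty_subset X)))
    rw [h1, Nat.mul_comm]
    exact Nat.mul_le_mul_left _ (upCount_le_card U 0)
  · have h1 : upCount M U 0 = 0 := by
      unfold upCount
      rw [card_eq_zero, filter_eq_empty_iff]
      intro X hX hcl
      rw [card_eq_zero.1 (mem_biIndepSets.1 hX).2.1] at hcl
      exact h0 hcl
    rw [h1]
    simp

/-! ### Closures at a coloop -/

/-- For a coloop `e` and `X ⊆ E` avoiding `e`: `cl_{M ∖ e} X = cl_M X`. -/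
theorem clF_delete_coloop_of_notMem {e : α} (he : e ∈ gr M) (hec : rk M ((gr M).erase e) + 1 = rk M (gr M))
    {X : Finset α} (hX : X ⊆ gr M) (heX : e ∉ X) : clF (M ＼ ({e} : Set α)) X = clF M X := by
  rw [clF_delete heX]
  exact erase_eq_of_notMem (notMem_clF_of_coloop' he hec hX heX)

/-- For a coloop `e` and `X ⊆ E` avoiding `e`: `cl_M (X ∪ e) = cl_M X ∪ e`. -/
theorem clF_insert_coloop {e : α} (he : e ∈ gr M) (hec : rk M ((gr M).erase e) + 1 = rk M (gr M))
    {X : Finset α} (hX : X ⊆ gr M) (heX : e ∉ X) : clF M (insert e X) = insert e (clF M X) := by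
  ext x
  by_cases hxe : x = e
  · subst hxe
    simp only [mem_insert, true_or, iff_true]
    exact subset_clF_fu (insert_subset he hX) (mem_insert_self _ _)
  · rw [mem_insert, or_iff_right hxe]
    by_cases hx : x ∈ gr M
    · exact mem_clF_insert_coloop_iff he hec hx hxe hX heX
    · exact ⟨fun h => absurd (clF_subset_gr_fu _ h) hx, fun h => absurd (clF_subset_gr_fu _ h) hx⟩

/-- A flat of `M` avoiding the coloop `e` is a flat of `M ∖ e`. -/
theorem isFlatF_delete_coloop_of_notMem {e : α} (he : e ∈ gr M) (hec : rk M ((gr M).erase e) + 1 = rk M (gr M))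
    {F : Finset α} (hF : IsFlatF M F) (heF : e ∉ F) : IsFlatF (M ＼ ({e} : Set α)) F := by
  refine ⟨?_, ?_⟩
  · rw [gr_delete']
    exact fun x hx => mem_erase.2 ⟨fun h => heF (h ▸ hx), hF.1 hx⟩
  · rw [clF_delete_coloop_of_notMem he hec hF.1 heF]
    exact hF.2

/-- A flat of `M` through the coloop `e` gives the flat `F ∖ e` of `M ∖ e`. -/
theorem isFlatF_delete_coloop_erase {e : α} (he : e ∈ gr M) (hec : rk M ((gr M).erase e) + 1 = rk M (gr M))
    {F : Finset α} (hF : IsFlatF M F) (heF : e ∈ F) : IsFlatF (M ＼ ({e} : Set α)) (F.erase e) := by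
  have hFe : F.erase e ⊆ gr M := (erase_subset _ _).trans hF.1
  refine ⟨?_, ?_⟩
  · rw [gr_delete']
    exact erase_subset_erase e hF.1
  · rw [clF_delete_coloop_of_notMem he hec hFe (notMem_erase e F)]
    apply Subset.antisymm
    · intro x hx
      have h1 : x ∈ clF M F := mem_clF_of_subset (erase_subset e F) hx
      rw [hF.2] at h1
      rw [mem_erase]
      refine ⟨?_, h1⟩
      rintro rfl
      exact notMem_clF_of_coloop' he hec hFe (notMem_erase x F) hx
    · exact subset_clF_fu hFe

/-- A flat of `M ∖ e` is a flat of `M` (`e` a coloop). -/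
theorem isFlatF_of_delete_coloop {e : α} (he : e ∈ gr M) (hec : rk M ((gr M).erase e) + 1 = rk M (gr M))
    {G : Finset α} (hG : IsFlatF (M ＼ ({e} : Set α)) G) : IsFlatF M G := by
  have hG1 := hG.1
  rw [gr_delete'] at hG1
  have heG : e ∉ G := fun h => (mem_erase.1 (hG1 h)).1 rfl
  have hGg : G ⊆ gr M := hG1.trans (erase_subset _ _)
  refine ⟨hGg, ?_⟩
  have h := hG.2
  rwa [clF_delete_coloop_of_notMem he hec hGg heG] at h

/-- `G ∪ e` is a flat of `M` for every flat `G` of `M ∖ e` (`e` a coloop). -/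
theorem isFlatF_insert_of_delete_coloop {e : α} (he : e ∈ gr M) (hec : rk M ((gr M).erase e) + 1 = rk M (gr M))
    {G : Finset α} (hG : IsFlatF (M ＼ ({e} : Set α)) G) : IsFlatF M (insert e G) := by
  have hG1 := hG.1
  rw [gr_delete'] at hG1
  have heG : e ∉ G := fun h => (mem_erase.1 (hG1 h)).1 rfl
  have hGg : G ⊆ gr M := hG1.trans (erase_subset _ _)
  have hG' := isFlatF_of_delete_coloop he hec hG
  refine ⟨insert_subset he hGg, ?_⟩
  rw [clF_insert_coloop he hec hGg heG, hG'.2]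

/-! ### The two up-sets of the deletion -/

/-- The members of `U` avoiding `e`. -/
noncomputable def coloopPart (U : Finset (Finset α)) (e : α) : Finset (Finset α) :=
  U.filter (fun F => e ∉ F)

/-- The members of `U` through `e`, with `e` removed. -/
noncomputable def coloopLift (U : Finset (Finset α)) (e : α) : Finset (Finset α) :=
  (U.filter (fun F => e ∈ F)).image (fun F => F.erase e)

/-- Membership in `U₀`. -/
theorem mem_coloopPart {U : Finset (Finset α)} {e : α} {F : Finset α} :
    F ∈ coloopPart U e ↔ F ∈ U ∧ e ∉ F := mem_filter

/-- Membership in `U₁`. -/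
theorem mem_coloopLift {U : Finset (Finset α)} {e : α} {G : Finset α} :
    G ∈ coloopLift U e ↔ ∃ F ∈ U, e ∈ F ∧ F.erase e = G := by
  unfold coloopLift
  rw [mem_image]
  constructor
  · rintro ⟨F, hF, rfl⟩
    exact ⟨F, (mem_filter.1 hF).1, (mem_filter.1 hF).2, rfl⟩
  · rintro ⟨F, hF, heF, rfl⟩
    exact ⟨F, mem_filter.2 ⟨hF, heF⟩, rfl⟩

/-- `U₀` is an up-set of flats of `M ∖ e`. -/
theorem upFlats_coloopPart {e : α} (he : e ∈ gr M) (hec : rk M ((gr M).erase e) + 1 = rk M (gr M))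
    {U : Finset (Finset α)} (hU : UpFlats M U) : UpFlats (M ＼ ({e} : Set α)) (coloopPart U e) where
  flat := by
    intro F hF
    rw [mem_coloopPart] at hF
    exact isFlatF_delete_coloop_of_notMem he hec (hU.flat F hF.1) hF.2
  up := by
    intro F hF G hG hFG
    rw [mem_coloopPart] at hF ⊢
    have hG1 := hG.1
    rw [gr_delete'] at hG1
    exact ⟨hU.up F hF.1 G (isFlatF_of_delete_coloop he hec hG) hFG, fun h => (mem_erase.1 (hG1 h)).1 rfl⟩

/-- `U₁` is an up-set of flats of `M ∖ e`. -/
theorem upFlats_coloopLift {e : α} (he : e ∈ gr M) (hec : rk M ((gr M).erase e) + 1 = rk M (gr M))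
    {U : Finset (Finset α)} (hU : UpFlats M U) : UpFlats (M ＼ ({e} : Set α)) (coloopLift U e) where
  flat := by
    intro G hG
    rw [mem_coloopLift] at hG
    obtain ⟨F, hF, heF, rfl⟩ := hG
    exact isFlatF_delete_coloop_erase he hec (hU.flat F hF) heF
  up := by
    intro G hG G' hG' hGG'
    rw [mem_coloopLift] at hG ⊢
    obtain ⟨F, hF, heF, rfl⟩ := hG
    have hG'1 := hG'.1
    rw [gr_delete'] at hG'1
    have heG' : e ∉ G' := fun h => (mem_erase.1 (hG'1 h)).1 rfl
    refine ⟨insert e G', hU.up F hF _ (isFlatF_insert_of_delete_coloop he hec hG') ?_, mem_insert_self _ _,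
      erase_insert heG'⟩
    intro x hx
    rw [mem_insert]
    by_cases hxe : x = e
    · exact Or.inl hxe
    · exact Or.inr (hGG' (mem_erase.2 ⟨hxe, hx⟩))

/-- `U₀ ⊆ U₁`. -/
theorem coloopPart_subset_coloopLift {e : α} (he : e ∈ gr M) (hec : rk M ((gr M).erase e) + 1 = rk M (gr M))
    {U : Finset (Finset α)} (hU : UpFlats M U) : coloopPart U e ⊆ coloopLift U e := by
  intro F hF
  rw [mem_coloopPart] at hF
  rw [mem_coloopLift]
  have hF' := isFlatF_delete_coloop_of_notMem he hec (hU.flat F hF.1) hF.2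
  exact ⟨insert e F, hU.up F hF.1 _ (isFlatF_insert_of_delete_coloop he hec hF') (subset_insert _ _),
    mem_insert_self _ _, erase_insert hF.2⟩

/-- `u_j(M′, U₀) ≤ u_j(M′, U₁)`. -/
theorem upCount_coloopPart_le {e : α} (he : e ∈ gr M) (hec : rk M ((gr M).erase e) + 1 = rk M (gr M))
    {U : Finset (Finset α)} (hU : UpFlats M U) (j : ℕ) :
    upCount (M ＼ ({e} : Set α)) (coloopPart U e) j ≤ upCount (M ＼ ({e} : Set α)) (coloopLift U e) j := by
  unfold upCount
  apply card_le_card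
  intro X hX
  rw [mem_filter] at hX ⊢
  exact ⟨hX.1, coloopPart_subset_coloopLift he hec hU hX.2⟩

/-! ### The split of `u_j` at a coloop -/

/-- The `e`-avoiding bi-independent `j`-sets of `M` with closure in `U` are the bi-independent `j`-sets of `M ∖ e` with
closure in `U₀`. -/
theorem card_filter_upCount_notMem_coloop {e : α} (he : e ∈ gr M) (hec : rk M ((gr M).erase e) + 1 = rk M (gr M))
    (U : Finset (Finset α)) (j : ℕ) :
    ((biIndepSets M j).filter (fun X => clF M X ∈ U ∧ e ∉ X)).card = upCount (M ＼ ({e} : Set α)) (coloopPart U e) j := by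
  unfold upCount
  apply congrArg Finset.card
  ext X
  rw [mem_filter, mem_filter, ← filter_biIndepSets_notMem_coloop he hec j, mem_filter, mem_coloopPart]
  constructor
  · rintro ⟨hX, hcl, heX⟩
    have hXg : X ⊆ gr M := (mem_biIndepSets.1 hX).1
    rw [clF_delete_coloop_of_notMem he hec hXg heX]
    exact ⟨⟨hX, heX⟩, hcl, notMem_clF_of_coloop' he hec hXg heX⟩
  · rintro ⟨⟨hX, heX⟩, hcl, -⟩
    have hXg : X ⊆ gr M := (mem_biIndepSets.1 hX).1
    rw [clF_delete_coloop_of_notMem he hec hXg heX] at hcl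
    exact ⟨hX, hcl, heX⟩

/-- The bi-independent `j`-sets of `M` through `e` with closure in `U` are, after removing `e`, the bi-independent
`(j−1)`-sets of `M ∖ e` with closure in `U₁` (`j ≥ 1`). -/
theorem card_filter_upCount_mem_coloop {e : α} (he : e ∈ gr M) (hec : rk M ((gr M).erase e) + 1 = rk M (gr M))
    (U : Finset (Finset α)) {j : ℕ} (hj : 1 ≤ j) :
    ((biIndepSets M j).filter (fun X => clF M X ∈ U ∧ e ∈ X)).card =
      upCount (M ＼ ({e} : Set α)) (coloopLift U e) (j - 1) := by
  unfold upCount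
  apply card_bij (fun X _ => X.erase e)
  · intro X hX
    rw [mem_filter] at hX
    obtain ⟨hXb, hcl, heX⟩ := hX
    have hXg : X ⊆ gr M := (mem_biIndepSets.1 hXb).1
    have hXe : X.erase e ⊆ gr M := (erase_subset _ _).trans hXg
    rw [mem_filter]
    refine ⟨erase_mem_biIndepSets_delete_of_coloop he hec hXb heX, ?_⟩
    rw [clF_delete_coloop_of_notMem he hec hXe (notMem_erase e X), mem_coloopLift]
    refine ⟨clF M X, hcl, subset_clF_fu hXg heX, ?_⟩
    have hX' : clF M X = insert e (clF M (X.erase e)) := by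
      have := clF_insert_coloop he hec hXe (notMem_erase e X)
      rwa [insert_erase heX] at this
    rw [hX', erase_insert (notMem_clF_of_coloop' he hec hXe (notMem_erase e X))]
  · intro X hX Y hY h
    rw [mem_filter] at hX hY
    rw [← insert_erase hX.2.2, ← insert_erase hY.2.2, h]
  · intro Y hY
    rw [mem_filter] at hY
    obtain ⟨hYb, hcl⟩ := hY
    have hYg' := (mem_biIndepSets.1 hYb).1
    rw [gr_delete'] at hYg'
    have heY : e ∉ Y := fun h => (mem_erase.1 (hYg' h)).1 rfl
    have hYg : Y ⊆ gr M := hYg'.trans (erase_subset _ _)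
    refine ⟨insert e Y, ?_, erase_insert heY⟩
    rw [mem_filter]
    refine ⟨insert_mem_biIndepSets_of_coloop he hec hj hYb, ?_, mem_insert_self _ _⟩
    rw [clF_delete_coloop_of_notMem he hec hYg heY, mem_coloopLift] at hcl
    obtain ⟨F, hF, heF, hFY⟩ := hcl
    rw [clF_insert_coloop he hec hYg heY]
    have hFeq : F = insert e (clF M Y) := by rw [← hFY, insert_erase heF]
    rw [← hFeq]
    exact hF

/-- **THE SPLIT AT A COLOOP**: `u_j(M, U) = u_j(M ∖ e, U₀) + u_{j−1}(M ∖ e, U₁)` for `j ≥ 1`. -/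
theorem upCount_coloop {e : α} (he : e ∈ gr M) (hec : rk M ((gr M).erase e) + 1 = rk M (gr M))
    (U : Finset (Finset α)) {j : ℕ} (hj : 1 ≤ j) :
    upCount M U j = upCount (M ＼ ({e} : Set α)) (coloopPart U e) j +
      upCount (M ＼ ({e} : Set α)) (coloopLift U e) (j - 1) := by
  rw [← card_filter_upCount_notMem_coloop he hec U j, ← card_filter_upCount_mem_coloop he hec U hj]
  unfold upCount
  rw [← card_filter_add_card_filter_not (s := (biIndepSets M j).filter (fun X => clF M X ∈ U)) (fun X => e ∉ X),
    filter_filter, filter_filter]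
  congr 2
  ext X
  simp only [mem_filter, not_not]

/-! ### The arithmetic of the step -/

/-- The step of (NC) at a coloop, in numbers: from the two steps of the deletion (`hi` at level `j` for `U₀`, `hii` at level
`j − 1` for `U₁`), `a_j ≤ b_j` and the log-concavity `P_{j−1} P_{j+1} ≤ P_j²` (with `u ≤ P` throughout). -/
theorem step_coloop_arith (a0 a1 b0 b1 P0 P1 P2 : ℕ) (ha0 : a0 ≤ P1) (hb0 : b0 ≤ P0) (hb1 : b1 ≤ P1)
    (hi : a0 * P2 ≤ a1 * P1) (hii : b0 * P1 ≤ b1 * P0) (hiv : a0 ≤ b1) (hlc : P0 * P2 ≤ P1 * P1) :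
    (a0 + b0) * (P2 + P1) ≤ (a1 + b1) * (P1 + P0) := by
  rcases Nat.eq_zero_or_pos P1 with h1 | h1
  · subst h1
    have ha : a0 = 0 := Nat.le_zero.1 ha0
    have hb : b1 = 0 := Nat.le_zero.1 hb1
    subst ha hb
    have h00 : P0 * P2 = 0 := Nat.le_zero.1 (by simpa using hlc)
    rw [Nat.mul_eq_zero] at h00
    rcases h00 with h0 | h2
    · subst h0
      obtain rfl : b0 = 0 := Nat.le_zero.1 hb0
      simp
    · subst h2
      simp
  · obtain ⟨d, rfl⟩ := Nat.exists_eq_add_of_le hiv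
    obtain ⟨Δ, hΔ⟩ := Nat.exists_eq_add_of_le hlc
    have h1' := Nat.mul_le_mul_right (P1 + P0) hi
    have h2' := Nat.mul_le_mul_right (P2 + P1) hii
    have key : (a0 + b0) * (P2 + P1) * P1 ≤ (a1 + (a0 + d)) * (P1 + P0) * P1 := by
      nlinarith [h1', h2', hΔ, Nat.zero_le (d * Δ), Nat.zero_le (a0 * Δ), Nat.zero_le (d * P0 * P2)]
    exact Nat.le_of_mul_le_mul_right key h1

/-! ### The step at a coloop, and the descent -/

/-- **THE STEP OF (NC) AT A COLOOP** (`j ≥ 1`): from the step of `(M ∖ e, U₀)` at level `j`, the step of `(M ∖ e, U₁)` at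
level `j − 1`, and the log-concavity of the profile of `M ∖ e` at `j`. -/
theorem normConsStep_coloop_of_lc {e : α} (he : e ∈ gr M) (hec : rk M ((gr M).erase e) + 1 = rk M (gr M))
    {U : Finset (Finset α)} (hU : UpFlats M U) {j : ℕ} (hj : 1 ≤ j)
    (h0 : NormConsStep (M ＼ ({e} : Set α)) (coloopPart U e) j)
    (h1 : NormConsStep (M ＼ ({e} : Set α)) (coloopLift U e) (j - 1))
    (hlc : (biIndepSets (M ＼ ({e} : Set α)) (j - 1)).card * (biIndepSets (M ＼ ({e} : Set α)) (j + 1)).card ≤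
      (biIndepSets (M ＼ ({e} : Set α)) j).card * (biIndepSets (M ＼ ({e} : Set α)) j).card) :
    NormConsStep M U j := by
  unfold NormConsStep at h0 h1 ⊢
  rw [upCount_coloop he hec U hj, upCount_coloop he hec U (by omega : 1 ≤ j + 1),
    card_biIndepSets_coloop he hec hj, card_biIndepSets_coloop he hec (by omega : 1 ≤ j + 1),
    show j + 1 - 1 = j by omega]
  rw [show j - 1 + 1 = j by omega] at h1
  exact step_coloop_arith _ _ _ _ _ _ _ (upCount_le_card _ _) (upCount_le_card _ _) (upCount_le_card _ _) h0 h1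
    (upCount_coloopPart_le he hec hU j) hlc

/-- (NC) for one matroid, at every up-set and every level. -/
def NormConsAt (M : Matroid α) [M.Finite] : Prop :=
  ∀ U : Finset (Finset α), UpFlats M U → ∀ j : ℕ, NormConsStep M U j

/-- The log-concavity of the binomials: `C(n, k−1) · C(n, k+1) ≤ C(n, k)²`. -/
theorem choose_mul_choose_le_sq (n k : ℕ) (hk : 1 ≤ k) :
    n.choose (k - 1) * n.choose (k + 1) ≤ n.choose k * n.choose k := by
  obtain ⟨k, rfl⟩ : ∃ k', k = k' + 1 := ⟨k - 1, by omega⟩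
  rw [show k + 1 - 1 = k by omega]
  rcases Nat.lt_or_ge n (k + 1) with hnk | hnk
  · rw [Nat.choose_eq_zero_of_lt (by omega : n < k + 1 + 1)]
    simp
  · have e1 := Nat.choose_succ_right_eq n k
    have e2 := Nat.choose_succ_right_eq n (k + 1)
    have hpos : 0 < (k + 1) * (k + 2) := by positivity
    have hab : (k + 1) * (n - (k + 1)) ≤ (n - k) * (k + 2) := by
      calc (k + 1) * (n - (k + 1)) ≤ (k + 2) * (n - k) := Nat.mul_le_mul (by omega) (by omega)
        _ = (n - k) * (k + 2) := Nat.mul_comm _ _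
    have h : n.choose k * n.choose (k + 1 + 1) * ((k + 1) * (k + 2)) ≤
        n.choose (k + 1) * n.choose (k + 1) * ((k + 1) * (k + 2)) := by
      calc n.choose k * n.choose (k + 1 + 1) * ((k + 1) * (k + 2))
          = (n.choose k * (k + 1)) * (n.choose (k + 1 + 1) * (k + 1 + 1)) := by ring
        _ = (n.choose k * (k + 1)) * (n.choose (k + 1) * (n - (k + 1))) := by rw [e2]
        _ = n.choose k * n.choose (k + 1) * ((k + 1) * (n - (k + 1))) := by ring
        _ ≤ n.choose k * n.choose (k + 1) * ((n - k) * (k + 2)) := Nat.mul_le_mul_left _ hab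
        _ = (n.choose k * (n - k)) * (n.choose (k + 1) * (k + 2)) := by ring
        _ = (n.choose (k + 1) * (k + 1)) * (n.choose (k + 1) * (k + 2)) := by rw [e1]
        _ = n.choose (k + 1) * n.choose (k + 1) * ((k + 1) * (k + 2)) := by ring
    exact Nat.le_of_mul_le_mul_right h hpos

/-- Theorem A's ultra-log-concavity (the named fact) gives the plain log-concavity `P_{j−1} P_{j+1} ≤ P_j²` of the
bi-independent profile. -/
theorem card_biIndepSets_mul_le_sq_of_fact (hfact : BiIndepDensityLogConcave α) (N : Matroid α) [N.Finite] {j : ℕ}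
    (hj : 1 ≤ j) :
    (biIndepSets N (j - 1)).card * (biIndepSets N (j + 1)).card ≤ (biIndepSets N j).card * (biIndepSets N j).card := by
  rcases Nat.lt_or_ge (gr N).card (j + 1) with hn | hn
  · have h0 : biIndepSets N (j + 1) = ∅ := by
      rw [eq_empty_iff_forall_notMem]
      intro X hX
      have hX' := mem_biIndepSets.1 hX
      have := card_le_card hX'.1
      omega
    rw [h0, card_empty]
    simp
  · have h := (hfact N).1 j hj hn
    have hb := choose_mul_choose_le_sq (gr N).card j hj
    have hpos : 0 < (gr N).card.choose j * (gr N).card.choose j :=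
      Nat.mul_pos (Nat.choose_pos (by omega)) (Nat.choose_pos (by omega))
    have h2 : (biIndepSets N (j - 1)).card * (biIndepSets N (j + 1)).card *
        ((gr N).card.choose j * (gr N).card.choose j) ≤
        (biIndepSets N j).card * (biIndepSets N j).card * ((gr N).card.choose j * (gr N).card.choose j) :=
      h.trans (Nat.mul_le_mul_left _ hb)
    exact Nat.le_of_mul_le_mul_right h2 hpos

/-- **(NC) DESCENDS THROUGH A COLOOP, MODULO THEOREM A**: if `M ∖ e` satisfies (NC) at every up-set and level, so does `M`
(`e` a coloop of `M`). -/
theorem normConsAt_of_delete_coloop_of_fact (hfact : BiIndepDensityLogConcave α) {e : α} (he : e ∈ gr M)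
    (hec : rk M ((gr M).erase e) + 1 = rk M (gr M)) (h : NormConsAt (M ＼ ({e} : Set α))) : NormConsAt M := by
  intro U hU j
  rcases Nat.eq_zero_or_pos j with hj | hj
  · subst hj
    exact normConsStep_zero hU
  · exact normConsStep_coloop_of_lc he hec hU hj (h _ (upFlats_coloopPart he hec hU) j)
      (h _ (upFlats_coloopLift he hec hU) (j - 1)) (card_biIndepSets_mul_le_sq_of_fact hfact _ hj)

/-- **MINIMAL (NC)-WITNESSES ARE COLOOP-FREE, MODULO THEOREM A**: an (NC)-witness `M` with a coloop `e` has the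
(NC)-witness `M ∖ e` on one element fewer. -/
theorem not_normConsAt_delete_coloop_of_fact (hfact : BiIndepDensityLogConcave α) {e : α} (he : e ∈ gr M)
    (hec : rk M ((gr M).erase e) + 1 = rk M (gr M)) (h : ¬ NormConsAt M) : ¬ NormConsAt (M ＼ ({e} : Set α)) :=
  fun h' => h (normConsAt_of_delete_coloop_of_fact hfact he hec h')

end PercRepro.Cogirth
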